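import Summits.BirchSwinnertonDyer.BirchSwinnertonDyer.Theorems.SignedLowerHalvesSmallImageLowerHalfBothSignsRttD2SeqJ3RInflation
import HarnessLib

/-!
# Route `SignedLowerHalves`, crux L `SmallImageLowerHalfBothSigns` (stmt-BirchSwinnertonDyer-23599), line `rtt_w3` v16 — E2, row J3 residual
# (`hsolL`), brick H1: DESCENT TO THE RESTRICTED-RAMIFICATION LAYER GROUP — a class of `H¹(U_n, X_k)` that dies on the inertia groups off `P`
# is inflated from honda's `H¹(G_P(K_n), X_k)` (`cycLayerCohO`), the converse of R4's `resLe_inf_inertia_inflNK_eq_zero`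

WIDTH seat `bsd-line-slh-p3-w3` g23 under LEAD `cruxlead-stmt-BirchSwinnertonDyer-23599` g11 (cell `bsd-ssimc`); helper `--supports stmt-BirchSwinnertonDyer-23599`.
THEOREMS ONLY (no definition, no named fact, no instance, no `sorry`). HONEST FRAMING: the image half of inflation–restriction for the closed normal
subgroup `N_P = ker(Γ_K ↠ G_P)` (topologically generated, as a normal subgroup, by the inertia groups at the primes outside `P`) inside an open layer
subgroup `U_n ⊇ N_P`, on continuous crossed homomorphisms; bookkeeping between R4's inflation `inflNK` and the Poitou–Tate output of H4. Nothing about any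
curve; E2, crux L, crux M, BSD remain OPEN and are proved for NO curve.

* `apply_eq_zero_of_mem_ramificationSubgroup` — a continuous crossed homomorphism `F : U_n → X_k` (`X_k` through `Γ_K ↠ G_P`) whose class dies on `U_n ⊓ I_𝔓` for
  every prime `𝔓` over a place `w ∉ P` vanishes on `N_P` (the zero set is a closed subgroup containing every `I_𝔓`, hence `N_P`).
* ★★ `exists_inflNK_eq_of_resLe_inertia` — such a class IS `inflNK S κ θ′ P n k ȳ` for some `ȳ ∈ cycLayerCohO S κ θ′ P n k 1` (the cocycle is constant on
  `N_P`-cosets and descends continuously along the open surjection `U_n → (U_n)_P`).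
References: [NeukirchSchmidtWingberg2008] (1.6.7), VIII §3; [SerreGaloisCohomology1997] I §2.6 (b).
-/

set_option autoImplicit false
set_option linter.dupNamespace false -- D-0017: single-problem summit, the namespace repeats the problem name by design
noncomputable section

open scoped Classical
open NumberField IsDedekindDomain Field CategoryTheory Function Topology

namespace Summit.BirchSwinnertonDyer.BirchSwinnertonDyer.Theorems.SmallImageRttD2Seq

open Literature.NumberTheory.EllipticCurves Literature.NumberTheory.GaloisRepresentations
  Literature.NumberTheory.ComplexMultiplication.EllipticUnits.JohnsonLeungKings2011
  Summit.BirchSwinnertonDyer.BirchSwinnertonDyer.Theorems.SmallImageRttD2J1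

section Descent

variable {K : Type} [Field K] {p : ℕ} [Fact p.Prime] (S : Set (PadicAlgCl p)) (κ : ZpExtension K p)
  (θ' : absoluteGaloisGroup K →ₜ* (padicCoeffIntegers S)ˣ) (P : Set (HeightOneSpectrum (𝓞 K)))

/-- The action of `U_n` on `X_k` factors through `G_P`: an element of `N_P` acts trivially. [cite: NeukirchSchmidtWingberg2008, VIII §3] -/
theorem coeffRepK_ρ_apply_eq_self_of_mem (k : ℕ) {σ : absoluteGaloisGroup K} (hσ : σ ∈ ramificationSubgroup K P)
    (x : (coeffRepK S θ' P k).toTopRep) : (coeffRepK S θ' P k).toTopRep.ρ σ x = x := by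
  change (coeffGSO S P θ' k) (toUnramifiedQuotCont K P σ) x = x
  have h1 : toUnramifiedQuot K P σ = 1 := (QuotientGroup.eq_one_iff σ).mpr hσ
  rw [toUnramifiedQuotCont_apply, h1, map_one]
  rfl

/-- Dialect bridge (definitional): the action of `u ∈ U_n` on `X_k` in `H¹(U_n, X_k)` is `coeffGSO` at the image of `u` in `G_P`. [folklore] -/
theorem subgroupRep_coeffRepK_ρ_apply (n k : ℕ) (u : ↥(κ.layerSubgroup n)) (y : (coeffRepK S θ' P k).toTopRep) :
    (subgroupRep (coeffRepK S θ' P k).toTopRep (κ.layerSubgroup n)).ρ u y = (coeffGSO S P θ' k) (toUnramifiedQuot K P u) y := rfl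

/-- Dialect bridge (definitional): the action of `q ∈ (U_n)_P` on `X_k` in honda's `cycLayerCohO` is `coeffGSO` at `q`. [folklore] -/
theorem levelRepO_layer_ρ_apply (n k : ℕ) (q : ↥(imGS P (κ.layerSubgroup n))) (y : (coeffRepK S θ' P k).toTopRep) :
    (levelRepO S P θ' (κ.layerSubgroup n) k).toTopRep.ρ q y = (coeffGSO S P θ' k) (q : GaloisGroupUnramifiedOutside K P) y := rfl

/-- Dialect bridge for the crossed-homomorphism identity: `x + u • y` read in `H¹(U_n, X_k)` equals `x + q • y` read in honda's `cycLayerCohO` when `u ↦ q`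
under `U_n → (U_n)_P`. [folklore] -/
theorem add_ρ_bridge (n k : ℕ) (u : ↥(κ.layerSubgroup n)) (q : ↥(imGS P (κ.layerSubgroup n)))
    (hq : toUnramifiedQuot K P u = (q : GaloisGroupUnramifiedOutside K P)) (x y : (subgroupRep (coeffRepK S θ' P k).toTopRep (κ.layerSubgroup n) : Type)) :
    x + (subgroupRep (coeffRepK S θ' P k).toTopRep (κ.layerSubgroup n)).ρ u y =
      (show ((levelRepO S P θ' (κ.layerSubgroup n) k).toTopRep : Type) from x) + (levelRepO S P θ' (κ.layerSubgroup n) k).toTopRep.ρ q y := by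
  have h : (subgroupRep (coeffRepK S θ' P k).toTopRep (κ.layerSubgroup n)).ρ u y = (levelRepO S P θ' (κ.layerSubgroup n) k).toTopRep.ρ q y := by
    rw [subgroupRep_coeffRepK_ρ_apply, levelRepO_layer_ρ_apply, hq]
  rw [h]

/-- A continuous crossed homomorphism `F : U_n → X_k` whose class dies on `U_n ⊓ I_𝔓`, `𝔓` a prime of `K̄` over a place `w ∉ P`, vanishes on `I_𝔓` (the
restricted class is principal, and `I_𝔓 ≤ N_P` acts trivially on `X_k`). [cite: NeukirchSchmidtWingberg2008, VIII §3] -/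
theorem apply_eq_zero_of_mem_inertia (n k : ℕ) (hNP : ramificationSubgroup K P ≤ κ.layerSubgroup n)
    (F : contOneCocycles (subgroupRep (coeffRepK S θ' P k).toTopRep (κ.layerSubgroup n)))
    {w : HeightOneSpectrum (𝓞 K)} (hw : w ∉ P) {𝔓 : Ideal (absIntegers (𝓞 K) K)} (h𝔓 : 𝔓 ∈ w.primesAbove)
    (hres : resLe (coeffRepK S θ' P k).toTopRep (inf_le_left : κ.layerSubgroup n ⊓ 𝔓.inertia (absoluteGaloisGroup K) ≤ κ.layerSubgroup n) 1
        (oneCocycleClass _ F) = 0)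
    {τ : absoluteGaloisGroup K} (hτI : τ ∈ 𝔓.inertia (absoluteGaloisGroup K)) : F.1 ⟨τ, hNP (inertia_le_ramificationSubgroup hw h𝔓 hτI)⟩ = 0 := by
  have hτN : τ ∈ ramificationSubgroup K P := inertia_le_ramificationSubgroup hw h𝔓 hτI
  rw [resLe_oneCocycleClass, oneCocycleClass_eq_zero_iff] at hres
  obtain ⟨a, ha⟩ := hres
  have h1 := ha ⟨τ, Subgroup.mem_inf.mpr ⟨hNP hτN, hτI⟩⟩
  have h2 : Literature.NumberTheory.EllipticCurves.subgroupInclusion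
      (inf_le_left : κ.layerSubgroup n ⊓ 𝔓.inertia (absoluteGaloisGroup K) ≤ κ.layerSubgroup n)
      ⟨τ, Subgroup.mem_inf.mpr ⟨hNP hτN, hτI⟩⟩ = ⟨τ, hNP hτN⟩ :=
    Subtype.ext (Literature.NumberTheory.EllipticCurves.subgroupInclusion_apply_coe _ _)
  have h3 : (subgroupRep (coeffRepK S θ' P k).toTopRep (κ.layerSubgroup n ⊓ 𝔓.inertia (absoluteGaloisGroup K))).ρ
      ⟨τ, Subgroup.mem_inf.mpr ⟨hNP hτN, hτI⟩⟩ a = a :=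
    coeffRepK_ρ_apply_eq_self_of_mem S θ' P k hτN a
  rw [contOneCocycles.pullback_apply, TopRep.hom_ofHom] at h1
  change F.1 (Literature.NumberTheory.EllipticCurves.subgroupInclusion _ _) = _ at h1
  rw [h2, h3, sub_self] at h1
  exact h1

set_option maxHeartbeats 400000 in
/-- **A crossed homomorphism on `U_n` dying on the inertia groups off `P` vanishes on `N_P`.** For a continuous crossed homomorphism `F : U_n → X_k` whose class
restricts to zero on `U_n ⊓ I_𝔓` for every prime `𝔓` of `K̄` over a place `w ∉ P`, and `N_P ≤ U_n`: `F(σ) = 0` for every `σ ∈ N_P` (on `U_n ∩ N_P` the crossed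
homomorphism is a homomorphism — `N_P` acts trivially on `X_k` —, its zero set there is a closed subgroup of `Γ_K` containing `I_𝔓` for all such `𝔓`, and these generate
`N_P` as a closed normal subgroup, the set of them being conjugation-stable). [cite: NeukirchSchmidtWingberg2008, VIII §3] [cite: SerreGaloisCohomology1997, I §2.6 (b)] -/
theorem apply_eq_zero_of_mem_ramificationSubgroup (n k : ℕ) (hNP : ramificationSubgroup K P ≤ κ.layerSubgroup n)
    (F : contOneCocycles (subgroupRep (coeffRepK S θ' P k).toTopRep (κ.layerSubgroup n)))
    (hF : ∀ w : HeightOneSpectrum (𝓞 K), w ∉ P → ∀ 𝔓 ∈ w.primesAbove,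
      resLe (coeffRepK S θ' P k).toTopRep (inf_le_left : κ.layerSubgroup n ⊓ 𝔓.inertia (absoluteGaloisGroup K) ≤ κ.layerSubgroup n) 1
        (oneCocycleClass _ F) = 0)
    {σ : absoluteGaloisGroup K} (hσ : σ ∈ ramificationSubgroup K P) : F.1 ⟨σ, hNP hσ⟩ = 0 := by
  -- the zero set of `F` on `U_n ∩ N_P`, as a subgroup of `U_n`
  let Z' : Subgroup ↥(κ.layerSubgroup n) :=
    { carrier := {u | (u : absoluteGaloisGroup K) ∈ ramificationSubgroup K P ∧ F.1 u = 0}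
      one_mem' := ⟨one_mem _, contOneCocycles.apply_one F⟩
      mul_mem' := fun {a b} ha hb ↦ ⟨mul_mem ha.1 hb.1, by
        rw [F.2 a b, ha.2, hb.2, zero_add]; exact ContinuousLinearMap.map_zero _⟩
      inv_mem' := fun {a} ha ↦ ⟨inv_mem ha.1, by
        have h := F.2 a⁻¹ a
        have h0 : ((subgroupRep (coeffRepK S θ' P k).toTopRep (κ.layerSubgroup n)).ρ a⁻¹) 0 = 0 := ContinuousLinearMap.map_zero _
        rw [inv_mul_cancel, contOneCocycles.apply_one, ha.2, h0, add_zero] at h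
        exact h.symm⟩ }
  -- ... and as a subgroup of `Γ_K`
  let Z : Subgroup (absoluteGaloisGroup K) := Z'.map (κ.layerSubgroup n).subtype
  have hZmem : ∀ {τ : absoluteGaloisGroup K}, τ ∈ Z ↔ ∃ hτ : τ ∈ κ.layerSubgroup n, τ ∈ ramificationSubgroup K P ∧ F.1 ⟨τ, hτ⟩ = 0 := by
    intro τ
    constructor
    · rintro ⟨u, hu, rfl⟩
      exact ⟨u.2, hu⟩
    · rintro ⟨hτ, h⟩
      exact ⟨⟨τ, hτ⟩, h, rfl⟩
  -- `Z` is closed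
  have hZ'cl : IsClosed (Z' : Set ↥(κ.layerSubgroup n)) := by
    have hset : (Z' : Set ↥(κ.layerSubgroup n)) =
        (Subtype.val ⁻¹' (ramificationSubgroup K P : Set (absoluteGaloisGroup K))) ∩ (F.1 ⁻¹' {0}) := Set.ext fun _ ↦ Iff.rfl
    rw [hset]
    exact ((ramificationSubgroup_isClosed K P).preimage continuous_subtype_val).inter (isClosed_singleton.preimage F.1.continuous)
  have hZcl : IsClosed (Z : Set (absoluteGaloisGroup K)) := by
    have hU : IsClosed ((κ.layerSubgroup n : Subgroup (absoluteGaloisGroup K)) : Set (absoluteGaloisGroup K)) :=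
      Subgroup.isClosed_of_isOpen _ (κ.isOpen_layerSubgroup n)
    have himg : (Z : Set (absoluteGaloisGroup K)) = Subtype.val '' (Z' : Set ↥(κ.layerSubgroup n)) := by
      ext τ
      simp only [SetLike.mem_coe, Set.mem_image]
      constructor
      · rintro ⟨u, hu, rfl⟩; exact ⟨u, hu, rfl⟩
      · rintro ⟨u, hu, rfl⟩; exact ⟨u, hu, rfl⟩
    rw [himg]
    exact hU.isClosedEmbedding_subtypeVal.isClosedMap _ hZ'cl
  -- every inertia group off `P` lies in `Z`
  have hIZ : inertiaOutside K P ⊆ Z := by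
    intro τ hτ
    rw [mem_inertiaOutside_iff] at hτ
    obtain ⟨w, hw, 𝔓, h𝔓, hτI⟩ := hτ
    have hτN : τ ∈ ramificationSubgroup K P := inertia_le_ramificationSubgroup hw h𝔓 hτI
    exact (hZmem).mpr ⟨hNP hτN, hτN, apply_eq_zero_of_mem_inertia S κ θ' P n k hNP F hw h𝔓 (hF w hw 𝔓 h𝔓) hτI⟩
  -- hence `N_P ≤ Z`
  have hNZ : ramificationSubgroup K P ≤ Z := by
    refine Subgroup.topologicalClosure_minimal _ ?_ hZcl
    refine (Subgroup.closure_le Z).mpr fun x hx ↦ ?_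
    obtain ⟨a, ha, hax⟩ := Group.mem_conjugatesOfSet_iff.mp hx
    obtain ⟨c, rfl⟩ := isConj_iff.mp hax
    exact hIZ (conj_mem_inertiaOutside ha c)
  exact ((hZmem).mp (hNZ hσ)).2.2

/-- Two elements of `U_n` with the same image in `G_P` give the same value of a crossed homomorphism vanishing on `N_P`. [folklore] -/
theorem apply_eq_apply_of_toUnramifiedQuot_eq (n k : ℕ) (hNP : ramificationSubgroup K P ≤ κ.layerSubgroup n)
    (F : contOneCocycles (subgroupRep (coeffRepK S θ' P k).toTopRep (κ.layerSubgroup n)))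
    (hF0 : ∀ (σ : absoluteGaloisGroup K) (hσ : σ ∈ ramificationSubgroup K P), F.1 ⟨σ, hNP hσ⟩ = 0)
    (u u' : ↥(κ.layerSubgroup n)) (h : toUnramifiedQuot K P u = toUnramifiedQuot K P u') : F.1 u = F.1 u' := by
  have hν : ((u' : absoluteGaloisGroup K))⁻¹ * u ∈ ramificationSubgroup K P := by
    rw [← QuotientGroup.eq]; exact h.symm
  have hu : u = u' * ⟨((u' : absoluteGaloisGroup K))⁻¹ * u, hNP hν⟩ := Subtype.ext (by
    change (u : absoluteGaloisGroup K) = u' * ((u' : absoluteGaloisGroup K)⁻¹ * u); rw [mul_inv_cancel_left])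
  rw [hu, F.2, hF0 _ hν, map_zero, add_zero]

/-- **The descended crossed homomorphism.** A continuous crossed homomorphism `F : U_n → X_k` vanishing on `N_P ≤ U_n` is the pull-back along
`U_n → (U_n)_P` of a continuous crossed homomorphism of `(U_n)_P` (constant on `N_P`-cosets; continuity because `U_n → (U_n)_P` is an open surjection,
hence a quotient map). [cite: NeukirchSchmidtWingberg2008, (1.6.7)] [cite: SerreGaloisCohomology1997, I §2.6 (b)] -/
theorem exists_cocycle_pullback_eq (n k : ℕ) (hNP : ramificationSubgroup K P ≤ κ.layerSubgroup n)
    (F : contOneCocycles (subgroupRep (coeffRepK S θ' P k).toTopRep (κ.layerSubgroup n)))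
    (hF0 : ∀ (σ : absoluteGaloisGroup K) (hσ : σ ∈ ramificationSubgroup K P), F.1 ⟨σ, hNP hσ⟩ = 0) :
    ∃ Fbar : contOneCocycles (levelRepO S P θ' (κ.layerSubgroup n) k).toTopRep,
      contOneCocycles.pullback (layerQuotHom κ P n) (inflMod S κ θ' P n k) Fbar = F := by
  -- a set-theoretic section of `U_n → (U_n)_P`
  have hex : ∀ q : ↥(imGS P (κ.layerSubgroup n)), ∃ u : ↥(κ.layerSubgroup n), layerQuotHom κ P n u = q := by
    rintro ⟨q, hq⟩
    obtain ⟨u, hu, huq⟩ := Subgroup.mem_map.mp hq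
    exact ⟨⟨u, hu⟩, Subtype.ext huq⟩
  choose lift hlift using hex
  have hliftq : ∀ q : ↥(imGS P (κ.layerSubgroup n)), toUnramifiedQuot K P (lift q : absoluteGaloisGroup K) = (q : GaloisGroupUnramifiedOutside K P) := by
    intro q
    have e := hlift q
    rw [Subtype.ext_iff, layerQuotHom_apply_coe] at e
    exact e
  have hwd : ∀ (u : ↥(κ.layerSubgroup n)), F.1 (lift (layerQuotHom κ P n u)) = F.1 u := fun u ↦
    apply_eq_apply_of_toUnramifiedQuot_eq S κ θ' P n k hNP F hF0 _ _ (by rw [hliftq, layerQuotHom_apply_coe])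
  have hmul : ∀ q q' : ↥(imGS P (κ.layerSubgroup n)), F.1 (lift (q * q')) = F.1 (lift q * lift q') := fun q q' ↦
    apply_eq_apply_of_toUnramifiedQuot_eq S κ θ' P n k hNP F hF0 _ _ (by
      rw [hliftq, Subgroup.coe_mul, Subgroup.coe_mul, map_mul, hliftq, hliftq])
  -- the open surjection `U_n → (U_n)_P` is a quotient map
  have hopen : IsOpenMap (layerQuotHom κ P n) := by
    intro V hV
    have h1 : IsOpen (Subtype.val '' V : Set (absoluteGaloisGroup K)) := (κ.isOpen_layerSubgroup n).isOpenEmbedding_subtypeVal.isOpenMap _ hV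
    have h2 : IsOpen (toUnramifiedQuot K P '' (Subtype.val '' V)) := isOpenMap_toUnramifiedQuot K P _ h1
    have h3 : (layerQuotHom κ P n '' V : Set ↥(imGS P (κ.layerSubgroup n))) = Subtype.val ⁻¹' (toUnramifiedQuot K P '' (Subtype.val '' V)) := by
      ext q
      simp only [Set.mem_image, Set.mem_preimage]
      constructor
      · rintro ⟨u, hu, rfl⟩
        exact ⟨u, ⟨u, hu, rfl⟩, rfl⟩
      · rintro ⟨_, ⟨u, hu, rfl⟩, huq⟩
        exact ⟨u, hu, Subtype.ext huq⟩
    rw [h3]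
    exact h2.preimage continuous_subtype_val
  have hquot : IsQuotientMap (layerQuotHom κ P n) :=
    hopen.isQuotientMap (layerQuotHom κ P n).continuous_toFun fun q ↦ ⟨lift q, hlift q⟩
  have hcont : Continuous fun q : ↥(imGS P (κ.layerSubgroup n)) ↦ F.1 (lift q) := by
    rw [hquot.continuous_iff]
    have hc : (fun q : ↥(imGS P (κ.layerSubgroup n)) ↦ F.1 (lift q)) ∘ layerQuotHom κ P n = fun u ↦ F.1 u := funext fun u ↦ hwd u
    rw [hc]
    exact F.1.continuous
  refine ⟨⟨⟨fun q ↦ F.1 (lift q), hcont⟩, fun q q' ↦ ?_⟩, Subtype.ext (ContinuousMap.ext fun u ↦ ?_)⟩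
  · show F.1 (lift (q * q')) = F.1 (lift q) + (levelRepO S P θ' (κ.layerSubgroup n) k).toTopRep.ρ q (F.1 (lift q'))
    rw [hmul q q', F.2 (lift q) (lift q')]
    exact add_ρ_bridge S κ θ' P n k (lift q) q (hliftq q) _ _
  · rw [contOneCocycles.pullback_apply]
    exact hwd u


/-- ★★ **Descent: a class of `H¹(U_n, X_k)` dying on the inertia groups off `P` is inflated from `H¹(G_P(K_n), X_k)`.** If `N_P ≤ U_n` and
`Y ∈ H¹(U_n, X_k)` restricts to zero on `U_n ⊓ I_𝔓` for every prime `𝔓` of `K̄` over every place `w ∉ P`, then `Y = inflNK S κ θ′ P n k ȳ` for some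
`ȳ ∈ cycLayerCohO S κ θ′ P n k 1` (a representing crossed homomorphism vanishes on `N_P`, is constant on `N_P`-cosets, and descends CONTINUOUSLY along the open
surjection `U_n → (U_n)_P`). [cite: NeukirchSchmidtWingberg2008, (1.6.7)] [cite: SerreGaloisCohomology1997, I §2.6 (b)] -/
theorem exists_inflNK_eq_of_resLe_inertia (n k : ℕ) (hNP : ramificationSubgroup K P ≤ κ.layerSubgroup n)
    (Y : continuousCohomology 1 (subgroupRep (coeffRepK S θ' P k).toTopRep (κ.layerSubgroup n)))
    (hY : ∀ w : HeightOneSpectrum (𝓞 K), w ∉ P → ∀ 𝔓 ∈ w.primesAbove,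
      resLe (coeffRepK S θ' P k).toTopRep (inf_le_left : κ.layerSubgroup n ⊓ 𝔓.inertia (absoluteGaloisGroup K) ≤ κ.layerSubgroup n) 1 Y = 0) :
    ∃ y : cycLayerCohO S κ θ' P n k 1, inflNK S κ θ' P n k y = Y := by
  obtain ⟨F, rfl⟩ := oneCocycleClass_surjective _ Y
  obtain ⟨Fbar, hFbar⟩ := exists_cocycle_pullback_eq S κ θ' P n k hNP F fun σ hσ ↦
    apply_eq_zero_of_mem_ramificationSubgroup S κ θ' P n k hNP F hY hσ
  refine ⟨oneCocycleClass _ Fbar, ?_⟩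
  rw [inflNK_apply]
  exact (map_oneCocycleClass _ _ _ Fbar).trans (congrArg (oneCocycleClass _) hFbar)

end Descent

end Summit.BirchSwinnertonDyer.BirchSwinnertonDyer.Theorems.SmallImageRttD2Seq

end
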